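import Summits.HodgeConjecture.HodgeConjecture.Theorems.FermatSurfaceSeparationCriterion

/-!
# Exotic Hodge pairs on Fermat squares, II — prime and quartic degrees, the residual family EXO-2′, Aoki σ-sets and the `σ₇` kernel lemma

Part 2 of 4 (Sketch §0 tail + §1, ll. 314–563):
* unconditional instances `isPairSymmetric_of_prime` ∕ `fermatSep_of_prime` (second proof of EXO-1) and `isPairSymmetric_of_four` ∕ `fermatSep_four`;
* what remains of the separation law after Aoki Thm A: `ExoTwoPrimeDegree m` (odd `m`, `7 ∣ m`, all other primes `≥ 11`), the statement
  `ExoTwoPrimeConjecture` (EXO-2′; PROVED in Part 3), `fermatSepCriterion_cases`, `fermatSep_of_criterion` (criterion ⇒ FermatSep GIVEN EXO-2′ and `AokiThmASix`);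
* Aoki's σ-sets `sigmaSet m p x = {x, x + m/p, …, x + (p−1)m/p} ⊎ {−p·x}`, `IsSigmaSet`, `StdOrSigma m p ℓ`, the hand-proved statement
  `TwoPrimeFirstExoticLength` (THEOREM P1AF-1 of memo ROUTE-P1AF §A: at `#s ≤ p+1`, `5 ≤ p < q`, every Hodge multiset of degree `pq` is standard or a σ_p-set;
  typed as a `Prop`, used only as a hypothesis — its kernel version is the tree's `CancelByAnyClaimLattice` PQ files);
* KERNEL: a `σ₇`-set contains no zero-sum sub-quadruple (`false_of_subquad_sigmaSet_seven`), hence `fermatSep_of_stdOrSigma_seven :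
  StdOrSigma m 7 8 → FermatSep m` for odd `m` with `7 ∣ m`, `fermatSep_seven_mul_prime`, `exoTwoPrimeDegree_seven_mul`.

PROVENANCE. Cell hodge-nonav (HUMAN RULING D-0038), planner seat p1: chapters ROUTE-P1AE §B (g32) and ROUTE-P1AF + ADD (g33),
frozen Sketch `HOME/p1/route/Sketch_P1AF_ADD_SEPLAW_g33.lean` (sha16 9c70bd8d356ffb70, 1004 lines, namespace `HodgeNonAV.P1AF`,
farm rc 0 / 0 sorries / axioms {propext, Classical.choice, Quot.sound}; referee PASS: REF-P1AF b32cd9c28a7cc495), split into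
four tree modules `FermatSurfaceSeparationCriterion` → `…Sigma` → `…Closures` → `FermatSurfaceSeparationLaw` by planner p1 g34
(landing kit HOME/p1/landing/, 2026-08-28); bodies verbatim, namespace moved to that of `Theorems/FermatSurfaceExoticPairsDefs`.
Land with `--supports stmt-HodgeConjecture-19652 --as helper` (K6 ∕ evidence carrier of the non-AV index) or `--supports
stmt-HodgeConjecture-1334` (the Fermat line whose engines §2 consumes). No instance, no notation, no sorry, no new axiom.
HONEST SCOPE: combinatorics of Shioda's Hodge-character semigroup of Fermat surfaces and sixfolds; NOTHING here proves the
Hodge conjecture or HC for any new variety — `FermatSep m` is the INPUT half of `HC⁴(X²ₘ × X²ₘ)` via the landed SQ-AUT theorem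
`PgOneCyclotomicSquares.hodgeConjectureFor_square_of_endomorphisms`, and those squares are dominated by Fermat/abelian motives anyway.
References: N. Aoki, Math. Ann. 266 (1983) Thm A, §1 (𝔇ⁿₘ), §5 Thm D, Prop. 6.4/6.6, Lemma 7.3 [cite: Aoki1983, Thm. A];
N. Aoki, J. Math. Soc. Japan 39 (1987) Thm 2-1 [cite: Aoki1987, Thm. 2-1]; N. Aoki, Comment. Math. Univ. St. Pauli 49 (2000) Lemma 4.1;
T. Shioda, Math. Ann. 245 (1979) Thm I–IV [cite: Shioda1979PJA, Thm. I]; Z. Ran, Compositio Math. 42 (1980) Prop. 1.8 [cite: Ran1980, Prop. 1.8];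
G. da Silva Jr., arXiv:2101.04739 (2021) Thm 2.1–2.2, Prop. 3.1 [cite: daSilva2021HodgeFermat, Thm. 2.1].
-/

set_option linter.dupNamespace false

noncomputable section

namespace Summit.HodgeConjecture.HodgeConjecture.Theorems.FermatSurfaceExoticPairs

open Multiset Literature.AlgebraicGeometry.HodgeTheory.FermatCharacter

variable {m : ℕ}

/-! ### unconditional instances: `m` prime (second proof of EXO-1) and `m = 4` -/

/-- For `m = p` prime every Hodge multiset is pair-symmetric (Ran ∕ Koblitz–Ogus, tree). [cite: Ran1980, Prop. 1.8 (i)] -/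
theorem isPairSymmetric_of_prime {p : ℕ} [Fact p.Prime] {s : Multiset (ZMod p)} (h : IsHodgeMultiset s) :
    IsPairSymmetric s := by
  haveI : NeZero p := ⟨(Fact.out : p.Prime).ne_zero⟩
  exact ⟨h.count_neg_eq_count, fun a ha hn ↦ by rw [count_eq_card_of_eq_neg h ha hn]; exact h.even_card⟩

/-- **EXO-1 bis: `FermatSep p` for `p` prime** (second proof, through pair symmetry; the tree's first proof is
`Theorems/FermatSurfaceExoticPairs.fermatSep_prime`). [cite: Ran1980, Prop. 1.8 (i)] [cite: Shioda1979PJA, Thm. 1] -/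
theorem fermatSep_of_prime {p : ℕ} [Fact p.Prime] : FermatSep p := by
  haveI : NeZero p := ⟨(Fact.out : p.Prime).ne_zero⟩
  exact fermatSep_of_pairSymmetric_octuples fun _ hs _ ↦ isPairSymmetric_of_prime hs

/-- For `m = 4` every Hodge multiset is pair-symmetric (tree `IsHodgeMultiset.count_of_four`).
[cite: daSilva2021HodgeFermat, Thm. 2.6] -/
theorem isPairSymmetric_of_four {s : Multiset (ZMod 4)} (h : IsHodgeMultiset s) : IsPairSymmetric s := by
  obtain ⟨h31, h2⟩ := h.count_of_four
  have hcases : ∀ x : ZMod 4, x = 0 ∨ x = 1 ∨ x = 2 ∨ x = 3 := by decide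
  have hneg1 : (-1 : ZMod 4) = 3 := by decide
  have hneg2 : (-2 : ZMod 4) = 2 := by decide
  have hneg3 : (-3 : ZMod 4) = 1 := by decide
  have hself : ∀ a : ZMod 4, a ≠ 0 → a = -a → a = 2 := by decide
  refine ⟨fun x ↦ ?_, fun a ha hn ↦ ?_⟩
  · rcases hcases x with rfl | rfl | rfl | rfl
    · rw [neg_zero]
    · rw [hneg1, h31]
    · rw [hneg2]
    · rw [hneg3, h31]
  · rw [hself a (h.1.1 a ha) hn]
    exact h2

/-- **`FermatSep 4`** (the quartic Fermat surface, a K3 surface: no exotic pairs). [cite: daSilva2021HodgeFermat, Thm. 2.6] -/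
theorem fermatSep_four : FermatSep 4 :=
  fermatSep_of_pairSymmetric_octuples fun _ hs _ ↦ isPairSymmetric_of_four hs

/-! ### §B3  what remains of EXO-2: the residual family EXO-2′ -/

/-- **EXO-2′, the residual degrees**: `m` odd, `7 ∣ m`, every prime factor `≥ 7` (`49, 77, 91, 119, 133, 161, …, 343, …`).
[cell hodge-nonav memo ROUTE-P1AE §B3] -/
def ExoTwoPrimeDegree (m : ℕ) : Prop :=
  Odd m ∧ 7 ∣ m ∧ ∀ p : ℕ, p.Prime → p ∣ m → 7 ≤ p

/-- **CONJECTURE EXO-2′** (cell memo ROUTE-P1AE §B3 — NOT proved, NOT a hypothesis of any tree theorem): `FermatSep m` for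
every residual degree. Census-true for `m ∈ {49, 77, 91, 119}` (`m ≤ 120`, kit j290871 ∕ j291259) and for the `7p`,
`133 ≤ m ≤ 301`, of kit j292589 (memo §C). Heuristic: for such `m` the only non-standard Hodge octuples are twists of
`σ_{7,a}` (Aoki Thm D shape), and `σ_{7,a} = {a, a+d, …, a+6d, -7a}` (`d = m/7`) has no zero-sum sub-quadruple, so it is
never of the form `u ∗ (−w)`. [cell hodge-nonav memo ROUTE-P1AE §B3; conjecture] -/
def ExoTwoPrimeConjecture : Prop :=
  ∀ m : ℕ, ExoTwoPrimeDegree m → FermatSep m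

/-- The trichotomy behind EXO-2: a degree satisfying the conjectured criterion is prime, or `4`, or has all prime
factors `> 8` (⇒ `FermatSep` by Aoki Thm A, `fermatSep_of_aokiThmASix`), or is a residual EXO-2′ degree. [folklore] -/
theorem fermatSepCriterion_cases (h : FermatSepCriterion m) :
    m.Prime ∨ m = 4 ∨ (∀ p : ℕ, p.Prime → p ∣ m → 8 < p) ∨ ExoTwoPrimeDegree m := by
  rcases h with hp | h4 | ⟨hodd, h7⟩
  · exact Or.inl hp
  · exact Or.inr (Or.inl h4)
  · by_cases hd : 7 ∣ m
    · exact Or.inr (Or.inr (Or.inr ⟨hodd, hd, h7⟩))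
    · refine Or.inr (Or.inr (Or.inl fun p hp hpm ↦ ?_))
      have h7p := h7 p hp hpm
      have hp7 : p ≠ 7 := by
        rintro rfl
        exact hd hpm
      have hp8 : p ≠ 8 := by
        rintro rfl
        exact absurd hp (by decide)
      omega

/-- **EXO-2, the `←` direction, reduced**: Aoki's Thm A (ii) at `n = 6` for all `m` plus EXO-2′ give `FermatSep m` for
every `m ≥ 2`… satisfying the criterion (primes: `fermatSep_of_prime`; `4`: `fermatSep_four`). [cell hodge-nonav memo ROUTE-P1AE §B3] -/
theorem fermatSep_of_criterion (hA : ∀ m : ℕ, AokiThmASix m) (hE : ExoTwoPrimeConjecture) (hm : 1 < m)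
    (h : FermatSepCriterion m) : FermatSep m := by
  haveI : NeZero m := ⟨by omega⟩
  rcases fermatSepCriterion_cases h with hp | rfl | h8 | hr
  · haveI : Fact m.Prime := ⟨hp⟩
    exact fermatSep_of_prime
  · exact fermatSep_four
  · exact fermatSep_of_aokiThmASix (hA m) h8
  · exact hE m hr


/-! ## §1  ROUTE-P1AF — the first exotic length at two primes -/

/-- Aoki's standard element of the second kind `σ_{p,x}` at a prime `p ∣ m`, as a MULTISET of residues:
`{x, x + d, …, x + (p-1)·d} ⊎ {-p·x}` with `d = m / p` (for `m = p·q`: `d = q`). It is a Hodge multiset of length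
`p + 1` (`∑_i ⟨t(x+id)/m⟩ = ⟨t x/d⟩… = {p t x/m} + (p-1)/2`, memo §A.5) and its class is algebraic by Aoki's explicit
cycles. [cite: Aoki1987, Thm. 2-1 (σ_{p,a}, (a, m/p) = 1)] [cite: Aoki1983, §5 Thm. D] (Aoki 2000, Lemma 4.1 (iii)) -/
def sigmaSet (m p : ℕ) (x : ZMod m) : Multiset (ZMod m) :=
  (Multiset.range p).map (fun i : ℕ ↦ x + (i : ZMod m) * ((m / p : ℕ) : ZMod m)) + {-((p : ZMod m) * x)}

/-- `s` is a `σ_p`-SET: `s = σ_{p,x}` for some `x` with `p·x ≠ 0` in `ℤ/m` (i.e. `(m/p) ∤ x`; for `m = p·q` this is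
exactly Aoki's condition `(x, m/p) = 1`). [cite: Aoki1987, Thm. 2-1] -/
def IsSigmaSet (p : ℕ) (s : Multiset (ZMod m)) : Prop :=
  ∃ x : ZMod m, (p : ZMod m) * x ≠ 0 ∧ s = sigmaSet m p x

/-- `𝔅 ⊆ 𝔇 ⊔ Σ_p` at length `ℓ`: every Hodge multiset of degree `m` with `ℓ` elements is standard or a `σ_p`-set.
[cell hodge-nonav memo ROUTE-P1AF §A] -/
def StdOrSigma (m p ℓ : ℕ) : Prop :=
  ∀ s : Multiset (ZMod m), IsHodgeMultiset s → card s = ℓ → IsStandard s ∨ IsSigmaSet p s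

/-- **THEOREM P1AF-1 (typed; proved by hand in memo ROUTE-P1AF §A, from the tree's `IsHodge.aoki_criterion` at the
three conductors `f ∈ {p, q, pq}` plus a counting argument; NOT kernel-proved).** For primes `5 ≤ p < q` with `q ≥ 11`,
every Hodge multiset of degree `p·q` with `ℓ ≤ p + 1` elements is standard or a `σ_p`-set (the latter forces
`ℓ = p + 1`). For `ℓ ≤ p - 1` this is Aoki 1983 Thm A (ii) (`𝔅ⁿ_{pq} = 𝔇ⁿ_{pq}`, every prime factor `> n + 2`); the
content is the FIRST EXOTIC LENGTH `ℓ = p + 1`, where Aoki's Prop. 6.4 (`p > ℓ + 1`), Prop. 6.6 (`p = ℓ + 1`) and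
Lemma 7.3 (every prime `> ℓ`) are silent. Why it might fail: it does not — but the hypotheses are sharp:
`(p, q) = (5, 7)` is outside (`m = 35` carries Aoki's exceptional sextuple class `ξ₃₅`-type phenomena at length 8, and
the counting bound `(p-1)(q-1)/4 > p+1` fails at length 6 only formally — census: no exception at (35, 6));
three or more prime factors, `p² ∣ m`, and `p = 3` (`ε(m)`, `ξ₁₅`, `ξ₂₁`) are genuinely different.
(Refs. for the covered ranges: Aoki1983 Thm. A (ii), Prop. 6.4, Prop. 6.6, Lemma 7.3 — they do NOT cover `ℓ = p + 1`; this statement is the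
cell's own claim, a HYPOTHESIS of `fermatSep_seven_mul_prime`, not a cited literature fact.) [cell hodge-nonav memo ROUTE-P1AF §A] -/
def TwoPrimeFirstExoticLength : Prop :=
  ∀ p q ℓ : ℕ, p.Prime → q.Prime → 5 ≤ p → p < q → 11 ≤ q → ℓ ≤ p + 1 → StdOrSigma (p * q) p ℓ

/-! ### kernel: a `σ₇`-set has no zero-sum sub-quadruple, hence `StdOrSigma m 7 8 → FermatSep m` -/

/-- `(2^k : ℤ/m)` is a unit for odd `m`. [folklore] -/
theorem isUnit_two_pow_of_odd (hodd : Odd m) (k : ℕ) : IsUnit ((2 ^ k : ℕ) : ZMod m) := by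
  rw [ZMod.isUnit_iff_coprime]
  exact Nat.Coprime.pow_left k (Nat.coprime_two_left.2 hodd)

/-- In `ℤ/m` with `m` odd: `2^k · y = 0 → y = 0`. [folklore] -/
theorem eq_zero_of_two_pow_mul_eq_zero (hodd : Odd m) (k : ℕ) {y : ZMod m}
    (h : ((2 ^ k : ℕ) : ZMod m) * y = 0) : y = 0 := by
  obtain ⟨u, hu⟩ := isUnit_two_pow_of_odd hodd k
  rw [← hu] at h
  simpa using congrArg (fun z ↦ (↑u⁻¹ : ZMod m) * z) h

/-- `7 · (m/7) = 0` in `ℤ/m` when `7 ∣ m`. [folklore] -/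
theorem seven_mul_div_eq_zero (h7 : 7 ∣ m) : (7 : ZMod m) * ((m / 7 : ℕ) : ZMod m) = 0 := by
  have h : ((7 * (m / 7) : ℕ) : ZMod m) = 0 := by rw [Nat.mul_div_cancel' h7, ZMod.natCast_self]
  simpa [Nat.cast_mul] using h

/-- Every element `a` of the arithmetic-progression part of `σ_{7,x}` has `7a = 7x`. [cite: Aoki1987, Thm. 2-1] -/
theorem seven_mul_eq_of_mem_range_part (h7 : 7 ∣ m) {x a : ZMod m}
    (ha : a ∈ (Multiset.range 7).map (fun i : ℕ ↦ x + (i : ZMod m) * ((m / 7 : ℕ) : ZMod m))) :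
    (7 : ZMod m) * a = 7 * x := by
  obtain ⟨i, -, rfl⟩ := Multiset.mem_map.1 ha
  rw [mul_add, mul_left_comm, seven_mul_div_eq_zero h7, mul_zero, add_zero]

/-- The apex `-7x` of `σ_{7,x}` is not in its arithmetic-progression part (`m` odd, `7x ≠ 0`). [cite: Aoki1987, Thm. 2-1] -/
theorem apex_not_mem_range_part (hodd : Odd m) (h7 : 7 ∣ m) {x : ZMod m} (hx : (7 : ZMod m) * x ≠ 0) :
    -((7 : ZMod m) * x) ∉ (Multiset.range 7).map (fun i : ℕ ↦ x + (i : ZMod m) * ((m / 7 : ℕ) : ZMod m)) := by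
  intro h
  have h1 := seven_mul_eq_of_mem_range_part h7 h
  -- `-49x = 7x`, so `56x = 8·(7x) = 0`, so `7x = 0`
  have h56 : (56 : ZMod m) * x = 0 := by linear_combination -h1
  have h2 : ((2 ^ 3 : ℕ) : ZMod m) * (7 * x) = 0 := by
    push_cast
    linear_combination h56
  exact hx (eq_zero_of_two_pow_mul_eq_zero hodd 3 h2)

/-- **No zero-sum sub-quadruple in a `σ₇`-set** (`m` odd, `7 ∣ m`, `7x ≠ 0`): a sub-multiset of `σ_{7,x}` with four
elements has sum `4x + d·(…)` or `-4x + d·(…)`, and `7·(±4x) = ±4·(7x) ≠ 0`. [cell hodge-nonav memo ROUTE-P1AF §B.1] -/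
theorem false_of_subquad_sigmaSet_seven (hodd : Odd m) (h7 : 7 ∣ m) {x : ZMod m} (hx : (7 : ZMod m) * x ≠ 0)
    {u : Multiset (ZMod m)} (hle : u ≤ sigmaSet m 7 x) (hc : card u = 4) (hsum : u.sum = 0) : False := by
  set R := (Multiset.range 7).map (fun i : ℕ ↦ x + (i : ZMod m) * ((m / 7 : ℕ) : ZMod m)) with hR
  set e : ZMod m := -((7 : ZMod m) * x) with he
  have hσ : sigmaSet m 7 x = R + {e} := by simp [sigmaSet, hR, he]
  -- split `u` into its apex part (a replicate of `e`) and the rest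
  have hsplit : u = u.filter (fun a ↦ a = e) + u.filter (fun a ↦ ¬ a = e) := (Multiset.filter_add_not _ u).symm
  set c := count e u with hcdef
  have hfe : u.filter (fun a ↦ a = e) = Multiset.replicate c e := by
    rw [hcdef, ← Multiset.filter_eq u e]
    exact Multiset.filter_congr fun a _ ↦ eq_comm
  -- `c ≤ 1`: `e` occurs once in `σ_{7,x}`
  have hc1 : c ≤ 1 := by
    have h1 : count e (sigmaSet m 7 x) = 1 := by
      rw [hσ, Multiset.count_add, Multiset.count_singleton_self,
        Multiset.count_eq_zero.2 (apex_not_mem_range_part hodd h7 hx)]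
    have := Multiset.count_le_of_le e hle
    omega
  -- every non-apex element of `u` lies in `R`, so `7a = 7x` there
  have hrest : ∀ a ∈ u.filter (fun a ↦ ¬ a = e), (7 : ZMod m) * a = 7 * x := by
    intro a ha
    rw [Multiset.mem_filter] at ha
    have hau : a ∈ sigmaSet m 7 x := Multiset.mem_of_le hle ha.1
    rw [hσ, Multiset.mem_add, Multiset.mem_singleton] at hau
    rcases hau with h | h
    · exact seven_mul_eq_of_mem_range_part h7 h
    · exact absurd h ha.2
  -- compute `7 · ∑ u` two ways
  set c' := card (u.filter (fun a ↦ ¬ a = e)) with hc'def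
  have hcc' : c + c' = 4 := by
    have := congrArg card hsplit
    rw [Multiset.card_add, hfe, Multiset.card_replicate, hc] at this
    omega
  have hmap : (u.map fun a ↦ (7 : ZMod m) * a) =
      Multiset.replicate c (7 * e) + Multiset.replicate c' (7 * x) := by
    conv_lhs => rw [hsplit]
    rw [Multiset.map_add, hfe, Multiset.map_replicate]
    congr 1
    rw [hc'def, ← Multiset.map_const']
    exact Multiset.map_congr rfl hrest
  have hL : ∀ v : Multiset (ZMod m), (v.map fun a ↦ (7 : ZMod m) * a).sum = 7 * v.sum := fun v ↦ by
    induction v using Multiset.induction_on with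
    | empty => simp
    | cons a s ih => rw [Multiset.map_cons, Multiset.sum_cons, Multiset.sum_cons, ih, mul_add]
  have h7sum : (7 : ZMod m) * u.sum = (c : ZMod m) * (7 * e) + (c' : ZMod m) * (7 * x) := by
    rw [← hL u, hmap, Multiset.sum_add, Multiset.sum_replicate, Multiset.sum_replicate, nsmul_eq_mul, nsmul_eq_mul]
  rw [hsum, mul_zero] at h7sum
  -- case on `c ∈ {0, 1}`; both give `4 · (7x) = 0`
  have h4 : ((2 ^ 2 : ℕ) : ZMod m) * (7 * x) = 0 := by
    interval_cases c
    · have hc' : c' = 4 := by omega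
      rw [hc'] at h7sum
      push_cast at h7sum ⊢
      linear_combination -h7sum
    · have hc' : c' = 3 := by omega
      rw [hc', he] at h7sum
      push_cast at h7sum ⊢
      linear_combination h7sum
  exact hx (eq_zero_of_two_pow_mul_eq_zero hodd 2 h4)

/-- **KERNEL — `𝔅⁶ₘ ⊆ 𝔇 ⊔ Σ₇ ⇒ FERMAT-SEPₘ`** (`m` odd, `7 ∣ m`): for a Hodge pair `(u, w)` the octuple `u ⊎ (-w)` is
standard (then `w = u`, P1AE kernel) or a `σ₇`-set (impossible: `u` would be a zero-sum sub-quadruple).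
[cell hodge-nonav memo ROUTE-P1AF §B.1] [cite: Aoki1983, Thm. A] -/
theorem fermatSep_of_stdOrSigma_seven [NeZero m] (hodd : Odd m) (h7 : 7 ∣ m) (h : StdOrSigma m 7 8) :
    FermatSep m := by
  rintro u w ⟨hu, hw, hs⟩
  have hcard : card (u + negM w) = 8 := by rw [Multiset.card_add, card_negM, hu.1, hw.1]
  rcases h _ hs hcard with hstd | ⟨x, hx, hσ⟩
  · have key := eq_negM_of_isPairSymmetric_add hu (isTransQuad_negM hw) (isPairSymmetric_of_isStandard hstd)
    have h' := congrArg negM key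
    rw [negM_negM, negM_negM] at h'
    exact h'.symm
  · exact (false_of_subquad_sigmaSet_seven hodd h7 hx (by rw [← hσ]; exact Multiset.le_add_right u _)
      hu.1 hu.2.2.1).elim

/-- **COROLLARY P1AF-2 (kernel modulo the hand-proved theorem): `FermatSep (7·q)` for every prime `q ≥ 11`** — the
two-prime case of conjecture EXO-2′ (`ExoTwoPrimeConjecture`), i.e. the Fermat surface of degree `7q` has no exotic
Hodge pairs; with the tree's SQ-AUT ∕ Shioda 1979 Thm II c2) this is the input to `HC⁴(X²_{7q} × X²_{7q})`.
[cell hodge-nonav memo ROUTE-P1AF §B] -/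
theorem fermatSep_seven_mul_prime (hT : TwoPrimeFirstExoticLength) {q : ℕ} (hq : q.Prime) (h11 : 11 ≤ q) :
    FermatSep (7 * q) := by
  haveI : NeZero (7 * q) := ⟨Nat.mul_ne_zero (by norm_num) hq.ne_zero⟩
  have hodd : Odd (7 * q) := Odd.mul (by decide) (hq.odd_of_ne_two (by omega))
  exact fermatSep_of_stdOrSigma_seven hodd (dvd_mul_right 7 q)
    (hT 7 q 8 (by norm_num) hq (by norm_num) (by omega) h11 (by norm_num))

/-- The residual two-prime EXO-2′ degrees `7·q` (`q ≥ 11` prime) are covered: `ExoTwoPrimeDegree (7·q)`. [folklore] -/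
theorem exoTwoPrimeDegree_seven_mul {q : ℕ} (hq : q.Prime) (h11 : 11 ≤ q) : ExoTwoPrimeDegree (7 * q) := by
  refine ⟨Odd.mul (by decide) (hq.odd_of_ne_two (by omega)), dvd_mul_right 7 q, fun p hp hpd ↦ ?_⟩
  rcases (Nat.Prime.dvd_mul hp).1 hpd with h | h
  · have := (Nat.prime_dvd_prime_iff_eq hp (by norm_num)).1 h
    omega
  · have := (Nat.prime_dvd_prime_iff_eq hp hq).1 h
    omega

end Summit.HodgeConjecture.HodgeConjecture.Theorems.FermatSurfaceExoticPairs

end
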